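import Literature.MathematicalPhysics.QuantumFieldTheory.Balaban1983to89.B8Ineq159CurvedCubeMemberLocalTower

/-!
# `Balaban1983to89.B8Ineq159CurvedCubeMemberReads` — [Balaban1985RegularSpaces] (1.59) p. 86 on the cube member: THE READ SET OF THE HYPOTHESES.
# Every datum of the member's (1.59) — the Landau stencil and the transpose `Q′(U₀)ᵀμ` of (1.38) at `x ∈ □₀`, the current `J_{U₀}φ` (1.55) at the bonds
# of `□_j`, the averages `Q_j(U₀)(iηφ)` on print's class — reads the background `U₀` ONLY on the sides of the plaquettes touching `□₀` (p. 77's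
# «p ∈ Ω₀» convention); and the derivative targets of (1.62) are dominated by the `|φ|`-target on the neighbouring side-touching bonds

statement-level skeleton of published theorems with citation tags; proofs where landed; nothing here is a claim about the
Yang–Mills mass gap

`[Balaban1985RegularSpaces]` ("B8", CMP **99** (1985) 75–102) p. 77 (the touching convention «we denote by `Ω` also the set of bonds … Similarly for the
corresponding set of plaquettes»), (1.1)–(1.2) p. 76, (1.29) p. 81, (1.31) p. 82, (1.38) p. 82, (1.55) p. 86, (1.59) p. 86, (1.62) p. 87, (1.131) p. 99, p. 98
(«for every j the cube □_j is a sum of the big blocks»); [4] = `[Balaban1985BackgroundPropagators]` (CMP **99** (1985) 389–434) (3.4) p. 391, (3.19) p. 393,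
(3.23)–(3.25) p. 394; [B7] = `[Balaban1985Averaging]` (CMP **98** (1985) 17–51) p. 24 (after (43)) «this definition is local».

CITATION HEADER (lean-in-tree rule).  Cell `pub-ymgap` (YM Track A, HUMAN RULING D-0062 ∕ D-0149), DAG node N05 = [B8], width seat `pub-ymgap-dag-n05-w3`
(g3), CLAIM-1 file (R).  WHY.  Files (F)∕(F′) of this seat (g2) localised the per-member curved (1.59) to backgrounds constrained on the BOX `□₀ + (Lᵐ + 3)`,
a neighbourhood of `Ω₀ = □₀`; print's class `𝔄_k({□_j}, α₀)` at the member's own domain sequence constrains ONLY the plaquettes touching `□₀`.  THIS FILE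
sharpens the locality to exactly that set: two backgrounds that agree on the SIDES OF THE PLAQUETTES TOUCHING `□₀` (`B8Eq140Level.SideTouches`) give the
same Landau identity, the same currents at the touching bonds and the same class averages — so the member's hypotheses transfer between them — and the
two derivative targets of (1.62) follow from the `|φ|`-target (with a member-dependent factor) for ANY unit-bounded background, so they need no read set.

THE MATHEMATICS (kernel-checked).  §1 `covLap_congr_bg_bonds` (`Δ^η_{U₀}g(x)` reads `U₀(x, ν)`, `U₀(x − e_ν, ν)` only), ★ `landauStencil_congr_touch`
(`Δ^η_{U₀}(𝟙_S D^{η*}_{U₀}A)(x)`, `x ∈ S`, reads the bonds TOUCHING `S`); §2 `under_of_inBox_blockBase`, ★ `QT_congr_cube` (`(Q′(U₀)ᵀμ)(x)` for a multiplier on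
the member's `Λ′`-tower reads the bonds INSIDE `□₀`: at each level either the block index of `x` lies outside `□_j^{(j)}` — then the summand is `Q′_jᵀ0 = 0` for
both backgrounds, `QprimeT_congr_fun` ∕ `QprimeT_zero` — or the whole `Lʲ`-block of `x` lies in `□_j ⊆ □₀`, p. 98, and `QprimeT_congr_bg` applies),
★ `isLandau138_congr_touch`; §3 ★ `Jcur_congr_bondNear` (`J_{U₀}(A)_μ(x)` reads `U₀` on the sides of the plaquettes through `⟨x, x + e_μ⟩`:
`B8Eq140Level.BondNear`), `Jcur_congr_touch`; §4 ★ `linCovIter_congr_cubeLamBP` (the class averages read bonds inside `□₀`: `cubeLamBP_box_subset_pred`, [B7]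
p. 24); §5 `eta_norm_le_of_targets` and ★ `derivTargets_of_phiTarget`: if `(Lʲη)|φ| ≤ C` on the side-touching bonds of every `□_j`, `j ≤ m`, and `φ = 0`
off them, then `(Lʲη)²|D^η_{U₀,ν}φ_τ| ≤ 2L^{2m}C` and `(Lʲη)³|Δ^η_{U₀}φ_τ| ≤ 4dL^{3m}C` there, for every `U1`-valued `U₀` (`‖R(u)X‖ ≤ ‖X‖`).

HONEST SCOPE ∕ A6.  Locality and triangle-inequality bookkeeping only; no constants of print; the targets lemma trades the orders of (1.62) for member-dependent
powers of `L` (acceptable only in the PER-MEMBER currency of this seat's files (D)–(H), NOT in [4] Thm 3.3's uniform one).  Count-neutral; N05 NOT discharged; no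
count claim; one finite `𝕋⁴` programme at fixed `ε`, Bałaban as printed; the YM mass gap (Clay) is NOT proved by any of this — R4 closes the conditional
finite-`𝕋⁴` rung `BalabanLadder.UV` only; nothing continuum ∕ ℝ⁴ ∕ OS.  No `sorry`, no `def`, no `instance`, no `notation`.  Unit `pub-ymgap-dag-n05-w3` (g3),
2026-08-28.
-/

noncomputable section

namespace Literature.MathematicalPhysics.QuantumFieldTheory.Balaban1983to89.B8Ineq159CurvedCubeMemberReads

open B7Prop1Explicit B7Prop2Explicit B7Prop1Local
open B7Eq78Linearization (conjR conjR_apply)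
open B7Prop4GeneralLevels (linCovIter)
open B8Ineq132 (covDerivFwd covDeriv BondTouches PlaqTouches Under norm_conjR_le)
open B8Eq140Level (SideTouches IsSide BondNear sideTouches_of_bondNear sideTouches_of_bondTouches bondNear_of plaqNear₁ plaqNear₃
  isSide₁ isSide₄ sideTouches_mono)
open B8Eq143PlaqExpansion (pdiv)
open B8Eq146AExpansion (iEta plaqCovDeriv plaqCovDeriv_eq_covDerivFwd)
open B8Eq155JBound (Jcur)
open B8Eq138LandauZd (IsLandau138 covLap covDivB qprimeT1 QprimeT QT QprimeT_zero)
open B8Eq131Cubes (cube sqLo sqHi cube_anti mem_cube_iff)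
open B8Eq131CubesAdmissible (cubeFam cubeFam_false_zero cubeFam_false_of_le)
open B8CubeMemberZd (cubeLamS)
open B8Ineq159FlatCubeMemberPrinted (cubeLamBP cubeLamBP_box_subset_pred cubeLamBP_zero_bondTouches)
open B8Ineq159FlatCubeMemberKernel (mem_cube_zero_iff)
open B8Ineq159FlatCubeMemberResidual (inBox_of_mem_cubeLamS)
open B8Ineq159CurvedCubeMemberLocal (covDivB_congr_bg)
open B8Ineq159CurvedCubeMemberLocalTower (QprimeT_congr_bg QprimeT_congr_fun)
open B9Ineq3137LocalSup (linCovIter_congr)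
open Literature.MathematicalPhysics.QuantumLattice (blockMap blockBase)

-- `Site` alone would resolve to the torus sites of `Setup.lean`; re-export the `ℤ^d` sites of `B7Prop1Explicit`.
export B7Prop1Explicit (Site)

variable {d : ℕ} {𝔸 : Type*} [NormedRing 𝔸] [NormOneClass 𝔸] [NormedAlgebra ℂ 𝔸] [CompleteSpace 𝔸]

/-! ## §1 The Landau stencil reads the bonds touching `S` -/

section Stencil

variable {η : ℝ} {U₀ U₀' : Site d → Fin d → 𝔸ˣ}

omit [NormOneClass 𝔸] [CompleteSpace 𝔸] in
/-- **`Δ^η_{U₀}g(x)` reads the background at the `2d` bonds `⟨x, x + e_ν⟩`, `⟨x − e_ν, x⟩` only** ((3.23): `Σ_ν D^{η*}_{U₀,ν}D^η_{U₀,ν}`; the outer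
`D^{η*}_ν` at `x` and the inner `D^η_ν` at `x − e_ν` both read `U₀(x − e_ν, ν)`, the inner `D^η_ν` at `x` reads `U₀(x, ν)`).
[cite: Balaban1985BackgroundPropagators, (3.23) p.394; Balaban1985RegularSpaces, (1.1) p.76] -/
theorem covLap_congr_bg_bonds (g : Site d → 𝔸) (x : Site d) (h0 : ∀ ν, U₀ x ν = U₀' x ν)
    (hm : ∀ ν, U₀ (x - e ν) ν = U₀' (x - e ν) ν) : covLap η U₀ g x = covLap η U₀' g x := by
  unfold covLap covDivB
  refine Finset.sum_congr rfl fun ν _ => ?_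
  simp only [covDeriv, covDerivFwd, hm ν, h0 ν]

omit [NormOneClass 𝔸] [CompleteSpace 𝔸] in
/-- ★ **THE LANDAU STENCIL OF (1.38) AT `x ∈ S` READS THE BONDS TOUCHING `S`**: `Δ^η_{U₀}(𝟙_S D^{η*}_{U₀}A)(x)` depends on `U₀(y, κ)` only for bonds
`⟨y, y + e_κ⟩` with an end-point in `S` — the divergence `D^{η*}_{U₀}A(y)`, `y ∈ S`, reads `U₀(y − e_ν, ν)` (end-point `y`), and the Laplacian at `x ∈ S` reads
`U₀(x, ν)`, `U₀(x − e_ν, ν)` (end-point `x`). [cite: Balaban1985RegularSpaces, (1.38) p.82, p.77 (touching convention); Balaban1985BackgroundPropagators, (3.23)–(3.25) p.394] -/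
theorem landauStencil_congr_touch (S : Set (Site d)) (A : Site d → Fin d → 𝔸) {x : Site d} (hx : x ∈ S)
    (h : ∀ (y : Site d) (κ : Fin d), BondTouches S y κ → U₀ y κ = U₀' y κ) :
    covLap η U₀ (S.indicator (covDivB η U₀ A)) x = covLap η U₀' (S.indicator (covDivB η U₀' A)) x := by
  classical
  have hg : S.indicator (covDivB η U₀ A) = S.indicator (covDivB η U₀' A) := by
    funext y
    by_cases hy : y ∈ S
    · rw [Set.indicator_of_mem hy, Set.indicator_of_mem hy]
      exact covDivB_congr_bg A y fun ν => h _ ν (Or.inr (by rw [sub_add_cancel]; exact hy))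
    · rw [Set.indicator_of_notMem hy, Set.indicator_of_notMem hy]
  rw [hg]
  exact covLap_congr_bg_bonds _ x (fun ν => h x ν (Or.inl hx)) fun ν => h _ ν (Or.inr (by rw [sub_add_cancel]; exact hx))

end Stencil

/-! ## §2 The transpose `Q′(U₀)ᵀμ` on the member's `Λ′`-tower reads the bonds inside `□₀` -/

section Transpose

variable {U₀ U₀' : Site d → Fin d → 𝔸ˣ}

/-- A site of the fine `Lʲ`-block `[Lʲy, Lʲy + (Lʲ − 1)𝟙]` lies under `y` (`B8Ineq132.Under`: `z ∈ Bʲ(y)`). [cite: Balaban1985RegularSpaces, p.79 («x₀ ∈ Bʲ(x_j)»), p.98] -/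
theorem under_of_inBox_blockBase {L : ℕ} (j : ℕ) (y z : Site d)
    (hz : InBox (blockBase (L ^ j) y) (blockBase (L ^ j) y + (((L : ℤ) ^ j) - 1) • (1 : Site d)) z) : Under L j y z := by
  intro i
  have h1 := hz i
  simp only [blockBase, Pi.add_apply, Pi.smul_apply, Pi.one_apply, smul_eq_mul, mul_one, Nat.cast_pow] at h1
  constructor
  · exact h1.1
  · have : (L : ℤ) ^ j * (y i + 1) = (L : ℤ) ^ j * y i + (L : ℤ) ^ j := by ring
    linarith [h1.2]

omit [NormOneClass 𝔸] in
/-- ★ **`(Q′(U₀)ᵀμ)(x)` FOR A MULTIPLIER ON THE MEMBER'S `Λ′`-TOWER READS THE BONDS INSIDE `□₀`** ((3.24) = `Σ_{j ≤ m} Q′_j(U₀)ᵀ(𝟙_{Λ′_j}μ_j)`; at level `j`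
either the block index `y_j(x)` lies outside `□_j^{(j)} ⊇ Λ′_j` — then the summand is `Q′_jᵀ 0 = 0` for every background (`QprimeT_congr_fun`, `QprimeT_zero`) —
or `x ∈ □_j` and its whole `Lʲ`-block lies in `□_j ⊆ □₀` (p. 98 «□_j is a sum of the big blocks»), where `Q′_jᵀ` reads `U₀` (`QprimeT_congr_bg`)).  So two
backgrounds agreeing on the bonds with both end-points in `□₀` have the same `Q′(·)ᵀμ` at every `x`, for `m ≤ k`.
[cite: Balaban1985BackgroundPropagators, (3.24) p.394, (3.19) p.393; Balaban1985RegularSpaces, (1.29) p.81, (1.131) p.99, p.98; Balaban1985Averaging, p.24 (after (43))] -/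
theorem QT_congr_cube {L : ℕ} (hL : 1 ≤ L) (a : Site d) (M ρ : ℕ) {k m : ℕ} (hmk : m ≤ k) (μ : ℕ → Site d → 𝔸) (x : Site d)
    (h : ∀ (z : Site d) (κ : Fin d), z ∈ cube L a M ρ k 0 → z + e κ ∈ cube L a M ρ k 0 → U₀ z κ = U₀' z κ) :
    QT L m (cubeLamS L a M ρ k m) U₀ μ x = QT L m (cubeLamS L a M ρ k m) U₀' μ x := by
  classical
  unfold QT
  refine Finset.sum_congr rfl fun j hj => ?_
  have hjm : j ≤ m := Nat.lt_succ_iff.mp (Finset.mem_range.mp hj)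
  have hjk : j ≤ k := hjm.trans hmk
  by_cases hb : InBox (sqLo L a ρ k j) (sqHi L a M ρ k j) (blockMap (L ^ j) x)
  · -- the whole `Lʲ`-block of `x` lies in `□_j ⊆ □₀`
    have hblk : ∀ z, InBox (blockBase (L ^ j) (blockMap (L ^ j) x))
        (blockBase (L ^ j) (blockMap (L ^ j) x) + (((L : ℤ) ^ j) - 1) • (1 : Site d)) z → z ∈ cube L a M ρ k 0 := fun z hz =>
      cube_anti (Nat.zero_le j) hjk ((mem_cube_iff hL).2 ⟨_, hb, under_of_inBox_blockBase j _ z hz⟩)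
    exact QprimeT_congr_bg hL j _ x fun z κ hz hzκ => h z κ (hblk z hz) (hblk _ hzκ)
  · -- the multiplier's indicator vanishes at the block index of `x`: both summands are `Q′_jᵀ 0 = 0`
    have h0 : (cubeLamS L a M ρ k m j).indicator (μ j) (blockMap (L ^ j) x) = (0 : Site d → 𝔸) (blockMap (L ^ j) x) :=
      Set.indicator_of_notMem (fun hmem => hb (inBox_of_mem_cubeLamS L a M ρ k hjm hmem)) _
    rw [QprimeT_congr_fun U₀ j x h0, QprimeT_congr_fun U₀' j x h0, QprimeT_zero L U₀ j x, QprimeT_zero L U₀' j x]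

omit [NormOneClass 𝔸] in
/-- ★ **THE LANDAU CONDITION (1.38) OF THE MEMBER TRANSFERS BETWEEN BACKGROUNDS AGREEING ON THE BONDS TOUCHING `□₀`** (same multiplier: the stencil side by
`landauStencil_congr_touch`, the transpose side by `QT_congr_cube`; `m ≤ k`). [cite: Balaban1985RegularSpaces, (1.38) p.82, p.77, (1.131) p.99; Balaban1985BackgroundPropagators, (3.23)–(3.25) p.394] -/
theorem isLandau138_congr_touch {L : ℕ} (hL : 1 ≤ L) {η : ℝ} (a : Site d) (M ρ : ℕ) {k m : ℕ} (hmk : m ≤ k) {A : Site d → Fin d → 𝔸}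
    (h : ∀ (z : Site d) (κ : Fin d), BondTouches (cube L a M ρ k 0) z κ → U₀ z κ = U₀' z κ)
    (hLan : IsLandau138 L m η (cubeFam false L a M ρ k 0) (cubeLamS L a M ρ k m) U₀ A) :
    IsLandau138 L m η (cubeFam false L a M ρ k 0) (cubeLamS L a M ρ k m) U₀' A := by
  obtain ⟨μ, hμ⟩ := hLan
  refine ⟨μ, fun x hx => ?_⟩
  rw [cubeFam_false_zero] at hx ⊢
  rw [← landauStencil_congr_touch (η := η) (cube L a M ρ k 0) A hx h, ← QT_congr_cube hL a M ρ hmk μ x fun z κ hz _ => h z κ (Or.inl hz)]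
  have := hμ x (by rw [cubeFam_false_zero]; exact hx)
  rwa [cubeFam_false_zero] at this

end Transpose

/-! ## §3 The current `J_{U₀}(A)` at a bond reads the sides of the plaquettes through the bond -/

section Current

variable {η : ℝ} {U₀ U₀' : Site d → Fin d → 𝔸ˣ}

omit [NormOneClass 𝔸] [CompleteSpace 𝔸] in
/-- ★ **THE CURRENT (1.55) AT `⟨x, x + e_μ⟩` READS THE BACKGROUND ON THE SIDES OF THE PLAQUETTES THROUGH THE BOND**: `J_{U₀}(A)_μ(x) =
Σ_{ν<μ}(D^{η*}_{U₀,ν}F_{νμ})(x) − Σ_{ν>μ}(D^{η*}_{U₀,ν}F_{μν})(x)`, `F = D^η_{U₀}A` ((1.2), (3.4)), reads `U₀(x, μ)`, `U₀(x, ν)`, `U₀(x − e_ν, ν)`, `U₀(x − e_ν, μ)`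
(`ν ≠ μ`) — sides of `p_{νμ}(x)` and `p_{νμ}(x − e_ν)` (`B8Eq140Level.BondNear μ x`). [cite: Balaban1985RegularSpaces, (1.55) p.86, (1.1)–(1.2) p.76; Balaban1985BackgroundPropagators, (3.4) p.391] -/
theorem Jcur_congr_bondNear (A : Site d → Fin d → 𝔸) (μ : Fin d) (x : Site d)
    (h : ∀ (y : Site d) (τ : Fin d), BondNear μ x y τ → U₀ y τ = U₀' y τ) : Jcur η U₀ A μ x = Jcur η U₀' A μ x := by
  have key : ∀ ν, ν ≠ μ → U₀ x μ = U₀' x μ ∧ U₀ x ν = U₀' x ν ∧ U₀ (x - e ν) ν = U₀' (x - e ν) ν ∧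
      U₀ (x - e ν) μ = U₀' (x - e ν) μ := fun ν hνμ =>
    ⟨h _ _ (bondNear_of (plaqNear₁ hνμ) (isSide₄ x ν μ)), h _ _ (bondNear_of (plaqNear₁ hνμ) (isSide₁ x ν μ)),
      h _ _ (bondNear_of (plaqNear₃ hνμ) (isSide₁ (x - e ν) ν μ)), h _ _ (bondNear_of (plaqNear₃ hνμ) (isSide₄ (x - e ν) ν μ))⟩
  rw [B8Eq155JBound.Jcur_def, B8Eq155JBound.Jcur_def]
  unfold pdiv
  congr 1
  · refine Finset.sum_congr rfl fun ν hν => ?_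
    obtain ⟨e1, e2, e3, e4⟩ := key ν (Finset.mem_Iio.mp hν).ne
    simp only [covDeriv, plaqCovDeriv_eq_covDerivFwd, covDerivFwd, e1, e2, e3, e4]
  · refine Finset.sum_congr rfl fun ν hν => ?_
    obtain ⟨e1, e2, e3, e4⟩ := key ν (Finset.mem_Ioi.mp hν).ne'
    simp only [covDeriv, plaqCovDeriv_eq_covDerivFwd, covDerivFwd, e1, e2, e3, e4]

omit [NormOneClass 𝔸] [CompleteSpace 𝔸] in
/-- **The current at a bond touching `S` reads the sides of plaquettes touching `S`** (a plaquette through a bond touching `S` touches `S`: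
`B8Eq140Level.sideTouches_of_bondNear`). [cite: Balaban1985RegularSpaces, (1.55) p.86, p.77 (touching convention)] -/
theorem Jcur_congr_touch {S : Set (Site d)} (A : Site d → Fin d → 𝔸) {μ : Fin d} {x : Site d} (hb : BondTouches S x μ)
    (h : ∀ (y : Site d) (τ : Fin d), SideTouches S y τ → U₀ y τ = U₀' y τ) : Jcur η U₀ A μ x = Jcur η U₀' A μ x :=
  Jcur_congr_bondNear A μ x fun y τ hn => h y τ (sideTouches_of_bondNear hb hn)

end Current

/-! ## §4 The class averages `Q_j(U₀)` on print's class read the bonds inside `□₀` -/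

section Averages

variable {U₀ U₀' : Site d → Fin d → 𝔸ˣ}

omit [NormOneClass 𝔸] in
/-- ★ **THE AVERAGES `Q_j(U₀)B` ON PRINT'S CLASS `cubeLamBP … m j` READ THE BONDS TOUCHING `□₀`**: for `j ≥ 1` the box `Bʲ(c₋) ∪ Bʲ(c₊)` of a class bond
lies in `□_{j−1} ⊆ □₀` (`cubeLamBP_box_subset_pred`, print's collar `L ≤ ρ`; [B7] p. 24 locality `linCovIter_congr`), so only bonds with BOTH end-points in `□₀`
are read; for `j = 0`, `Q₀ = id` reads no background at all. [cite: Balaban1985RegularSpaces, (1.31) p.82, (1.131) p.99, p.98; Balaban1985Averaging, p.24 (after (43)); Balaban1984PropagatorsII, (2.3) p.224] -/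
theorem linCovIter_congr_cubeLamBP {L : ℕ} (hL : 1 ≤ L) (a : Site d) (M : ℕ) {ρ : ℕ} (hρ : L ≤ ρ) {k m : ℕ} (hmk : m ≤ k)
    (B : Site d → Fin d → 𝔸) (h : ∀ (z : Site d) (κ : Fin d), z ∈ cube L a M ρ k 0 → z + e κ ∈ cube L a M ρ k 0 → U₀ z κ = U₀' z κ)
    {j : ℕ} {c : Site d × Fin d} (hc : c ∈ cubeLamBP L a M ρ k m j) : linCovIter L U₀ B j c.1 c.2 = linCovIter L U₀' B j c.1 c.2 := by
  rcases Nat.lt_or_ge j 1 with h0 | h1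
  · have hj0 : j = 0 := by omega
    subst hj0
    simp only [B7Prop4GeneralLevels.linCovIter_zero]
  · have hjk : j - 1 ≤ k := by have := hc.1; omega
    refine linCovIter_congr L hL j c.1 c.2 (fun z κ hz hzκ => h z κ ?_ ?_) (fun _ _ _ _ => rfl)
    · exact cube_anti (Nat.zero_le _) hjk (cubeLamBP_box_subset_pred hL a M hρ h1 hmk hc z hz)
    · exact cube_anti (Nat.zero_le _) hjk (cubeLamBP_box_subset_pred hL a M hρ h1 hmk hc _ hzκ)

end Averages

/-! ## §5 The derivative targets of (1.62) from the `|φ|`-target -/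

section Targets

variable {η : ℝ} {U₀ : Site d → Fin d → 𝔸ˣ}

omit [NormOneClass 𝔸] [NormedAlgebra ℂ 𝔸] [CompleteSpace 𝔸] in
/-- **A field bounded by `C∕(Lʲη)` on the side-touching bonds of the `□_j` and vanishing elsewhere is bounded by `C∕η` everywhere** (`L ≥ 1`).
[cite: Balaban1985RegularSpaces, (1.59) p.86, (1.62) p.87] -/
theorem eta_norm_le_of_targets {L : ℕ} (hL : 1 ≤ L) (hη : 0 < η) {m : ℕ} (Ω : ℕ → Set (Site d)) {φ : Site d → Fin d → 𝔸}
    (hs : ∀ (y : Site d) (τ : Fin d), (∀ j, j ≤ m → ¬ SideTouches (Ω j) y τ) → φ y τ = 0) {C : ℝ} (hC : 0 ≤ C)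
    (hφ : ∀ j, j ≤ m → ∀ (y : Site d) (τ : Fin d), SideTouches (Ω j) y τ → ((L : ℝ) ^ j * η) * ‖φ y τ‖ ≤ C)
    (y : Site d) (τ : Fin d) : η * ‖φ y τ‖ ≤ C := by
  classical
  by_cases hex : ∃ j, j ≤ m ∧ SideTouches (Ω j) y τ
  · obtain ⟨j, hj, hst⟩ := hex
    have hLj : (1 : ℝ) ≤ (L : ℝ) ^ j := one_le_pow₀ (by exact_mod_cast hL)
    calc η * ‖φ y τ‖ ≤ ((L : ℝ) ^ j * η) * ‖φ y τ‖ := by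
          apply mul_le_mul_of_nonneg_right _ (norm_nonneg _)
          nlinarith
      _ ≤ C := hφ j hj y τ hst
  · push Not at hex
    rw [hs y τ fun j hj => hex j hj, norm_zero, mul_zero]
    exact hC

omit [CompleteSpace 𝔸] in
/-- ★ **THE DERIVATIVE TARGETS OF (1.62) FROM THE `|φ|`-TARGET, for every `U1`-valued background.**  If `(Lʲη)|φ(b)| ≤ C` on the side-touching bonds `b` of
every `□_j`, `j ≤ m`, and `φ = 0` off them, then on those bonds `(Lʲη)²|D^η_{U₀,ν}φ_τ| ≤ 2L^{2m}C` and `(Lʲη)³|Δ^η_{U₀}φ_τ| ≤ 4dL^{3m}C` — the covariant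
differences read `φ` at the bond and its neighbours, each `≤ C∕η` (`eta_norm_le_of_targets`), through unit-bounded transports `‖R(u)X‖ ≤ ‖X‖`.  (Per-member
bookkeeping: the orders `(Lʲη)^{−2}, (Lʲη)^{−3}` of print are traded for powers of `L ≤ Lᵐ`.) [cite: Balaban1985RegularSpaces, (1.62) p.87, (1.59) p.86, (1.1) p.76; Balaban1985BackgroundPropagators, (3.23) p.394] -/
theorem derivTargets_of_phiTarget {L : ℕ} (hL : 1 ≤ L) (hη : 0 < η) {m : ℕ} (Ω : ℕ → Set (Site d)) (hU : ∀ x κ, U₀ x κ ∈ U1 𝔸)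
    {φ : Site d → Fin d → 𝔸} (hs : ∀ (y : Site d) (τ : Fin d), (∀ j, j ≤ m → ¬ SideTouches (Ω j) y τ) → φ y τ = 0) {C : ℝ} (hC : 0 ≤ C)
    (hφ : ∀ j, j ≤ m → ∀ (y : Site d) (τ : Fin d), SideTouches (Ω j) y τ → ((L : ℝ) ^ j * η) * ‖φ y τ‖ ≤ C)
    {j : ℕ} (hj : j ≤ m) (y : Site d) (τ : Fin d) :
    (∀ ν : Fin d, ((L : ℝ) ^ j * η) ^ 2 * ‖covDerivFwd η U₀ ν (fun z => φ z τ) y‖ ≤ 2 * (L : ℝ) ^ (2 * m) * C) ∧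
      ((L : ℝ) ^ j * η) ^ 3 * ‖covLap η U₀ (fun z => φ z τ) y‖ ≤ 4 * d * (L : ℝ) ^ (3 * m) * C := by
  have hb : ∀ z, η * ‖φ z τ‖ ≤ C := fun z => eta_norm_le_of_targets hL hη Ω hs hC hφ z τ
  have hL1 : (1 : ℝ) ≤ L := by exact_mod_cast hL
  have hLjm : (L : ℝ) ^ j ≤ (L : ℝ) ^ m := pow_le_pow_right₀ hL1 hj
  have hLj0 : (0 : ℝ) ≤ (L : ℝ) ^ j := by positivity
  -- the forward difference: `η²‖D^η_ν f(z)‖ = η‖R(·)f(z + e_ν) − f z‖ ≤ η‖f(z + e_ν)‖ + η‖f z‖ ≤ 2C`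
  have hD : ∀ (ν : Fin d) (z : Site d), η ^ 2 * ‖covDerivFwd η U₀ ν (fun w => φ w τ) z‖ ≤ 2 * C := by
    intro ν z
    have e1 : η ^ 2 * ‖covDerivFwd η U₀ ν (fun w => φ w τ) z‖ = η * ‖conjR (U₀ z ν) (φ (z + e ν) τ) - φ z τ‖ := by
      simp only [covDerivFwd, norm_smul, norm_inv, Real.norm_eq_abs, abs_of_pos hη]
      field_simp
    rw [e1]
    calc η * ‖conjR (U₀ z ν) (φ (z + e ν) τ) - φ z τ‖ ≤ η * (‖conjR (U₀ z ν) (φ (z + e ν) τ)‖ + ‖φ z τ‖) :=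
          mul_le_mul_of_nonneg_left (norm_sub_le _ _) hη.le
      _ ≤ η * (‖φ (z + e ν) τ‖ + ‖φ z τ‖) := by gcongr; exact norm_conjR_le (hU z ν) _
      _ = η * ‖φ (z + e ν) τ‖ + η * ‖φ z τ‖ := by ring
      _ ≤ C + C := add_le_add (hb _) (hb _)
      _ = 2 * C := by ring
  refine ⟨fun ν => ?_, ?_⟩
  · calc ((L : ℝ) ^ j * η) ^ 2 * ‖covDerivFwd η U₀ ν (fun z => φ z τ) y‖
          = ((L : ℝ) ^ j) ^ 2 * (η ^ 2 * ‖covDerivFwd η U₀ ν (fun z => φ z τ) y‖) := by ring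
      _ ≤ ((L : ℝ) ^ m) ^ 2 * (2 * C) :=
          mul_le_mul (pow_le_pow_left₀ hLj0 hLjm 2) (hD ν y) (by positivity) (by positivity)
      _ = 2 * (L : ℝ) ^ (2 * m) * C := by ring
  · -- the Laplacian: `d` backward differences of the forward differences, each `≤ 4C∕η³`
    have hterm : ∀ ν : Fin d, η ^ 3 * ‖covDeriv η U₀ ν (fun z => covDerivFwd η U₀ ν (fun w => φ w τ) z) y‖ ≤ 4 * C := by
      intro ν
      set g : Site d → 𝔸 := fun z => covDerivFwd η U₀ ν (fun w => φ w τ) z with hg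
      have hgb : ∀ z, η ^ 2 * ‖g z‖ ≤ 2 * C := fun z => hD ν z
      have e1 : η ^ 3 * ‖covDeriv η U₀ ν g y‖ = η ^ 2 * ‖conjR (U₀ (y - e ν) ν)⁻¹ (g (y - e ν)) - g y‖ := by
        simp only [covDeriv, norm_smul, norm_inv, Real.norm_eq_abs, abs_of_pos hη]
        field_simp
      rw [e1]
      calc η ^ 2 * ‖conjR (U₀ (y - e ν) ν)⁻¹ (g (y - e ν)) - g y‖ ≤ η ^ 2 * (‖conjR (U₀ (y - e ν) ν)⁻¹ (g (y - e ν))‖ + ‖g y‖) :=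
            mul_le_mul_of_nonneg_left (norm_sub_le _ _) (by positivity)
        _ ≤ η ^ 2 * (‖g (y - e ν)‖ + ‖g y‖) := by gcongr; exact norm_conjR_le ((U1 𝔸).inv_mem (hU _ ν)) _
        _ = η ^ 2 * ‖g (y - e ν)‖ + η ^ 2 * ‖g y‖ := by ring
        _ ≤ 2 * C + 2 * C := add_le_add (hgb _) (hgb _)
        _ = 4 * C := by ring
    have hsum : η ^ 3 * ‖covLap η U₀ (fun z => φ z τ) y‖ ≤ 4 * d * C := by
      unfold covLap covDivB
      calc η ^ 3 * ‖∑ ν : Fin d, covDeriv η U₀ ν (fun z => covDerivFwd η U₀ ν (fun w => φ w τ) z) y‖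
          ≤ η ^ 3 * ∑ ν : Fin d, ‖covDeriv η U₀ ν (fun z => covDerivFwd η U₀ ν (fun w => φ w τ) z) y‖ :=
            mul_le_mul_of_nonneg_left (norm_sum_le _ _) (by positivity)
        _ = ∑ ν : Fin d, η ^ 3 * ‖covDeriv η U₀ ν (fun z => covDerivFwd η U₀ ν (fun w => φ w τ) z) y‖ := by rw [Finset.mul_sum]
        _ ≤ ∑ _ν : Fin d, 4 * C := Finset.sum_le_sum fun ν _ => hterm ν
        _ = 4 * d * C := by simp only [Finset.sum_const, Finset.card_univ, Fintype.card_fin, nsmul_eq_mul]; ring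
    calc ((L : ℝ) ^ j * η) ^ 3 * ‖covLap η U₀ (fun z => φ z τ) y‖
        = ((L : ℝ) ^ j) ^ 3 * (η ^ 3 * ‖covLap η U₀ (fun z => φ z τ) y‖) := by ring
      _ ≤ ((L : ℝ) ^ m) ^ 3 * (4 * d * C) :=
          mul_le_mul (pow_le_pow_left₀ hLj0 hLjm 3) hsum (by positivity) (by positivity)
      _ = 4 * d * (L : ℝ) ^ (3 * m) * C := by ring

end Targets

end Literature.MathematicalPhysics.QuantumFieldTheory.Balaban1983to89.B8Ineq159CurvedCubeMemberReads

end
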